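import Summits.QuantumAdvantage.QuantumAdvantage.Theorems.PureCubicClassNumberHard.Negative.WellPosed
import Literature.Computability.Complexity.PairProjections
import Literature.Computability.Complexity.PairPlumbing

/-!
# `PureCubicClassNumberHard`: worst-case hardness is infinitely-often hardness (negative knowledge)

Crux `stmt-QuantumAdvantage-11826` (route `LinnikCubicClassGroups`, `X = PureCubicClassNumberHard`).
Sequel of `Negative/WellPosed.lean` (normal form `crux_iff_targetBits_hard`). Refuter work file:
`Summits/QuantumAdvantage/QuantumAdvantage/Cruxes/PureCubicClassNumberHard/Disproof.lean`.

* `isPolyTime_patch`: PPT algorithms (`RandAlg.IsPolyTime id id`) are closed under patching ONE input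
  with a fixed answer — assembled from the tree's string `FP` toolkit (`iteFn_mem_FP`,
  `eqPairFn_mem_FP`, `fanoutFn_mem_FP`, pair projections, `PolyTimeComputable.comp_holds`,
  `PolyTimeComputable.of_encode_eq`).
* `hard_iff_infinitely_often` (generic target `t`, validity predicate `P`): "no PPT algorithm is
  correct w.p. `≥ 2/3` on every valid input" `↔` "every PPT algorithm fails on infinitely many valid
  inputs".
* `crux_iff_infinitely_often_hard`: the crux `X` in that form; `crux_iff_infinitely_many_lengths`:
  equivalently, failures at inputs of infinitely many lengths (finitely many inputs per length).
* MODEL NOTE `isPolyTime_outputs_any_unary_predicate`: the tree's `RandAlg.IsPolyTime` does not ask the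
  coin budget `coinLen` to be computable, and `run` sees `|r| = coinLen |x|` — so it is PPT with
  `O(log n)` advice: every unary predicate (e.g. the halting set in unary) is output with certainty by
  an `IsPolyTime` algorithm (`adviceAlg`). Harmless for the crux (it only makes `X` the slightly stronger
  "hard for PPT/log"), recorded for auditors of `Randomized.lean`.
-/

namespace Summit.QuantumAdvantage.QuantumAdvantage.Theorems.PureCubicClassNumberHard.Negative

open Literature.Computability.Complexity _root_.Computability
open Summit.QuantumAdvantage.QuantumAdvantage.Theses.LinnikCubicClassGroups (PureCubicClassNumberHard)

/-! ## Worst-case hardness = infinitely-often hardness (finite patching of PPT algorithms) -/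

/-- `A` patched at the single input `x₀` with the fixed answer `v` (same coins, ignored there). -/
def patch (A : RandAlg (List Bool) (List Bool)) (x₀ v : List Bool) : RandAlg (List Bool) (List Bool) where
  run x r := if x = x₀ then v else A.run x r
  coinLen := A.coinLen

/-- The string-level run map `z ↦ A.run (boolUnpair z).1 (boolUnpair z).2` of a PPT algorithm is in
`FP` (normalise the input word through the pair projections, then run `A`'s machine). [folklore] -/
theorem uncurry_run_comp_boolUnpair_mem_FP {A : RandAlg (List Bool) (List Bool)}
    (hA : A.IsPolyTime id id) : (Function.uncurry A.run ∘ boolUnpair) ∈ FP := by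
  have hN : (fun z : List Bool => boolPair (boolUnpair z).1 (boolUnpair z).2) ∈ FP := by
    have h := fanoutFn_mem_FP boolUnpairFst_mem_FP boolUnpairSnd_mem_FP
    have hfun : fanoutFn (fun z => (boolUnpair z).1) (fun z => (boolUnpair z).2) =
        fun z : List Bool => boolPair (boolUnpair z).1 (boolUnpair z).2 :=
      funext fun z => fanoutFn_apply _ _ z
    rw [hfun] at h
    exact h
  have hunpair : PolyTimeComputable (id : List Bool → List Bool)
      (fun p : List Bool × List Bool => boolPair p.1 p.2) boolUnpair :=
    PolyTimeComputable.of_encode_eq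
      (f := fun z : List Bool => boolPair (boolUnpair z).1 (boolUnpair z).2)
      (ea := (id : List Bool → List Bool)) (eb := (id : List Bool → List Bool))
      (id : List Bool → List Bool) (fun _ => rfl) (fun _ => rfl) hN
  exact PolyTimeComputable.comp_holds hA.1 hunpair

/-- String-level patch: test "first component `= x₀`", then either the constant `v` or `g`. -/
noncomputable def patchStr (g : List Bool → List Bool) (x₀ v : List Bool) : List Bool → List Bool :=
  iteFn (eqPairFn ∘ fanoutFn (fun z => (boolUnpair z).1) (fun _ => x₀)) (fun _ => v) g

/-- The string-level patch of an `FP` function is in `FP` (tree toolkit: `iteFn_mem_FP`,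
`eqPairFn_mem_FP`, `fanoutFn_mem_FP`, `boolUnpairFst_mem_FP`, `const_mem_FP`). [folklore] -/
theorem patchStr_mem_FP {g : List Bool → List Bool} (hg : g ∈ FP) (x₀ v : List Bool) :
    patchStr g x₀ v ∈ FP :=
  iteFn_mem_FP
    (PolyTimeComputable.comp_holds eqPairFn_mem_FP
      (fanoutFn_mem_FP boolUnpairFst_mem_FP (const_mem_FP x₀)))
    (const_mem_FP v) hg

/-- On a well-formed pair `⟨x, r⟩` the string-level patch is the intended case distinction. [folklore] -/
theorem patchStr_boolPair (g : List Bool → List Bool) (x₀ v x r : List Bool) :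
    patchStr g x₀ v (boolPair x r) = if x = x₀ then v else g (boolPair x r) := by
  unfold patchStr
  have hc : (eqPairFn ∘ fanoutFn (fun z => (boolUnpair z).1) (fun _ => x₀)) (boolPair x r) =
      [decide (x = x₀)] := by
    simp only [Function.comp_apply, fanoutFn_apply, boolUnpair_boolPair, eqPairFn_boolPair]
  rw [iteFn_apply hc]
  by_cases h : x = x₀ <;> simp [h]

/-- **PPT algorithms are closed under patching one input.** [folklore] -/
theorem isPolyTime_patch {A : RandAlg (List Bool) (List Bool)} (hA : A.IsPolyTime id id)
    (x₀ v : List Bool) : (patch A x₀ v).IsPolyTime id id := by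
  refine ⟨?_, hA.2⟩
  have hg := patchStr_mem_FP (uncurry_run_comp_boolUnpair_mem_FP hA) x₀ v
  refine PolyTimeComputable.of_encode_eq
    (f := patchStr (Function.uncurry A.run ∘ boolUnpair) x₀ v)
    (ea := (id : List Bool → List Bool)) (eb := (id : List Bool → List Bool))
    (fun p : List Bool × List Bool => boolPair p.1 p.2) (fun _ => rfl) (fun p => ?_) hg
  obtain ⟨x, r⟩ := p
  simp only [id, patchStr_boolPair, Function.comp_apply, boolUnpair_boolPair,
    Function.uncurry_apply_pair]
  rfl

/-- At the patched input the patched algorithm answers `v` with probability `1`. [folklore] -/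
theorem pr_patch_self (A : RandAlg (List Bool) (List Bool)) (x₀ v : List Bool) :
    (patch A x₀ v).pr id x₀ {v} = 1 := by
  have h : (patch A x₀ v).outputPMF id x₀ = PMF.pure v := by
    simp only [RandAlg.outputPMF, patch]
    exact PMF.map_const _ _
  rw [RandAlg.pr, h, PMF.toOuterMeasure_pure_apply]
  simp

/-- Away from the patched input the output law is unchanged. [folklore] -/
theorem pr_patch_of_ne (A : RandAlg (List Bool) (List Bool)) (x₀ v : List Bool) {x : List Bool}
    (hx : x ≠ x₀) (E : Set (List Bool)) : (patch A x₀ v).pr id x E = A.pr id x E := by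
  simp only [RandAlg.pr, RandAlg.outputPMF, patch, if_neg hx]

/-- **Worst-case hardness is automatically infinitely-often hardness.** For any target function `t`
and input-validity predicate `P`: "no PPT algorithm is correct (w.p. `≥ 2/3`) on every valid input"
is EQUIVALENT to "every PPT algorithm fails on INFINITELY many valid inputs" — a PPT algorithm
failing on finitely many inputs is patched input by input (`isPolyTime_patch`). [folklore] -/
theorem hard_iff_infinitely_often (t : List Bool → List Bool) (P : List Bool → Prop) :
    (¬ ∃ A : RandAlg (List Bool) (List Bool), A.IsPolyTime id id ∧
        ∀ x, P x → (2 : ℝ) / 3 ≤ A.pr id x {t x}) ↔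
      ∀ A : RandAlg (List Bool) (List Bool), A.IsPolyTime id id →
        {x | P x ∧ A.pr id x {t x} < 2 / 3}.Infinite := by
  constructor
  · intro hX A hA
    by_contra hfin
    rw [Set.not_infinite] at hfin
    have key : ∀ (S : Finset (List Bool)) (B : RandAlg (List Bool) (List Bool)),
        B.IsPolyTime id id → {x | P x ∧ B.pr id x {t x} < 2 / 3} ⊆ ↑S →
          ∃ C : RandAlg (List Bool) (List Bool), C.IsPolyTime id id ∧
            ∀ x, P x → (2 : ℝ) / 3 ≤ C.pr id x {t x} := by
      intro S
      induction S using Finset.induction_on with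
      | empty =>
        intro B hB hsub
        exact ⟨B, hB, fun x hx => not_lt.mp fun hlt => by simpa using hsub ⟨hx, hlt⟩⟩
      | insert x₀ S _ ih =>
        intro B hB hsub
        refine ih (patch B x₀ (t x₀)) (isPolyTime_patch hB _ _) ?_
        rintro x ⟨hPx, hlt⟩
        have hne : x ≠ x₀ := by
          rintro rfl
          rw [pr_patch_self] at hlt
          norm_num at hlt
        rw [pr_patch_of_ne _ _ _ hne] at hlt
        have hx := hsub ⟨hPx, hlt⟩
        rw [Finset.coe_insert] at hx
        rcases hx with rfl | hx
        · exact absurd rfl hne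
        · exact hx
    obtain ⟨C, hC, hcorr⟩ := key hfin.toFinset A hA (fun x hx => by simpa using hx)
    exact hX ⟨C, hC, hcorr⟩
  · rintro h ⟨A, hA, hcorr⟩
    refine h A hA ?_
    have hempty : {x | P x ∧ A.pr id x {t x} < 2 / 3} = ∅ := by
      ext x
      simp only [Set.mem_setOf_eq, Set.mem_empty_iff_false, iff_false, not_and, not_lt]
      exact hcorr x
    rw [hempty]
    exact Set.finite_empty

/-- **`X` ↔ every PPT algorithm fails on INFINITELY MANY non-cube inputs** (normal form §2 +
`hard_iff_infinitely_often`): the crux cannot be weakened to / is not stronger than its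
"infinitely often" reading; any proof must defeat each PPT algorithm on an infinite set. [folklore] -/
theorem crux_iff_infinitely_often_hard :
    PureCubicClassNumberHard ↔
      ∀ A : RandAlg (List Bool) (List Bool), A.IsPolyTime id id →
        {x | (∀ r : ℕ, r ^ 3 ≠ decodeNat x) ∧ A.pr id x {targetBits x} < 2 / 3}.Infinite :=
  crux_iff_targetBits_hard.trans
    (hard_iff_infinitely_often targetBits fun x => ∀ r : ℕ, r ^ 3 ≠ decodeNat x)


/-- **… and at inputs of infinitely many LENGTHS.** Since there are finitely many inputs of each
length (`List.finite_length_le`), "fails on infinitely many inputs" upgrades for free to "fails at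
inputs of infinitely many different lengths `|x|`" — the form in which a hardness hypothesis is
usually consumed (infinitely many input sizes `n` with a hard instance of size `n`). [folklore] -/
theorem crux_iff_infinitely_many_lengths :
    PureCubicClassNumberHard ↔
      ∀ A : RandAlg (List Bool) (List Bool), A.IsPolyTime id id →
        {n : ℕ | ∃ x : List Bool, x.length = n ∧ (∀ r : ℕ, r ^ 3 ≠ decodeNat x) ∧
          A.pr id x {targetBits x} < 2 / 3}.Infinite := by
  rw [crux_iff_infinitely_often_hard]
  refine ⟨fun h A hA => ?_, fun h A hA => ?_⟩
  · intro hfin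
    obtain ⟨N, hN⟩ := hfin.bddAbove
    refine h A hA ((List.finite_length_le (α := Bool) (n := N)).subset ?_)
    rintro x ⟨hm, hlt⟩
    exact hN ⟨x, rfl, hm, hlt⟩
  · intro hfin
    refine h A hA (Set.Finite.subset (Set.Finite.image List.length hfin) ?_)
    rintro n ⟨x, hx, hm, hlt⟩
    exact ⟨x, ⟨hm, hlt⟩, hx⟩

/-! ## Model note: `RandAlg.IsPolyTime` is PPT with `O(log n)` advice (the coin budget is not required to be computable) -/

/-- The one-bit-advice algorithm: ignores `x`, reads only the NUMBER of coins it is handed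
(`coinLen |x| ∈ {0, 1}`, chosen by the arbitrary predicate `a`) and reports it. -/
def adviceAlg (a : ℕ → Bool) : RandAlg (List Bool) (List Bool) where
  run _ r := [decide (r.length = 1)]
  coinLen n := if a n then 1 else 0

/-- String-level run map of `adviceAlg`: `⟨x, r⟩ ↦ [|r| = 1]`, assembled from FP bricks. -/
noncomputable def adviceStr : List Bool → List Bool :=
  eqPairFn ∘ fanoutFn (onesFn ∘ fun z => (boolUnpair z).2) (fun _ => [true])

/-- `adviceStr ∈ FP` (bricks `eqPairFn`, `fanoutFn`, `onesFn`, second pair projection, constants). [folklore] -/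
theorem adviceStr_mem_FP : adviceStr ∈ FP :=
  PolyTimeComputable.comp_holds eqPairFn_mem_FP
    (fanoutFn_mem_FP (PolyTimeComputable.comp_holds onesFn_mem_FP boolUnpairSnd_mem_FP)
      (const_mem_FP [true]))

/-- `1^{|r|} = 1` iff `|r| = 1`. [folklore] -/
theorem onesFn_eq_singleton_iff (r : List Bool) : onesFn r = [true] ↔ r.length = 1 := by
  constructor
  · intro h
    have := congrArg List.length h
    simpa using this
  · intro h
    have h1 : onesFn r = onesFn [false] := by rw [onesFn, onesFn, h]; rfl
    rw [h1]
    rfl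

/-- On a pair `⟨x, r⟩`, `adviceStr` reports whether `|r| = 1`. [folklore] -/
theorem adviceStr_boolPair (x r : List Bool) : adviceStr (boolPair x r) = [decide (r.length = 1)] := by
  simp only [adviceStr, Function.comp_apply, fanoutFn_apply, boolUnpair_boolPair, eqPairFn_boolPair]
  rw [Bool.decide_congr (onesFn_eq_singleton_iff r)]

/-- `adviceAlg a` is PPT in the tree's sense, WHATEVER `a` is. [folklore] -/
theorem isPolyTime_adviceAlg (a : ℕ → Bool) : (adviceAlg a).IsPolyTime id id := by
  refine ⟨?_, ⟨1, fun n => ?_⟩⟩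
  · refine PolyTimeComputable.of_encode_eq (f := adviceStr) (ea := (id : List Bool → List Bool))
      (eb := (id : List Bool → List Bool)) (fun p : List Bool × List Bool => boolPair p.1 p.2)
      (fun _ => rfl) (fun p => ?_) adviceStr_mem_FP
    obtain ⟨x, r⟩ := p
    simp only [id, adviceStr_boolPair, Function.uncurry_apply_pair]
    rfl
  · show (if a n then 1 else 0) ≤ Polynomial.eval n 1
    rw [Polynomial.eval_one]
    split <;> omega

/-- … and it outputs `[a |x|]` with probability `1`. [folklore] -/
theorem pr_adviceAlg (a : ℕ → Bool) (x : List Bool) : (adviceAlg a).pr id x {[a x.length]} = 1 := by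
  have hconst : (fun r : List.Vector Bool ((adviceAlg a).coinLen (id x).length) =>
      (adviceAlg a).run x r.toList) = fun _ => [a x.length] := by
    funext r
    have hr : r.toList.length = (if a x.length then 1 else 0) := by
      rw [List.Vector.toList_length]; rfl
    show [decide (r.toList.length = 1)] = [a x.length]
    rw [hr]
    cases a x.length <;> simp
  have hpmf : (adviceAlg a).outputPMF id x = PMF.pure [a x.length] := by
    unfold RandAlg.outputPMF
    rw [hconst]
    exact PMF.map_const _ _
  rw [RandAlg.pr, hpmf, PMF.toOuterMeasure_pure_apply]
  simp

/-- **MODEL NOTE (statement hygiene, affects every `RandAlg.IsPolyTime` statement incl. this crux).**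
The tree's PPT notion bounds the coin budget `coinLen` by a polynomial but does not ask it to be
COMPUTABLE, and `run` sees `|r| = coinLen |x|`; hence `IsPolyTime` = PPT with `O(log n)` bits of
(possibly uncomputable) advice per input length. Demonstration: EVERY unary predicate `a : ℕ → Bool` —
e.g. the halting set in unary — is output with certainty by some `IsPolyTime` algorithm. For the crux
this is harmless (advice of `O(log |x|)` bits cannot carry the class numbers of the `2^{|x|}` inputs of a
length; `X` merely becomes the slightly STRONGER hypothesis "hard even for PPT/log", still implied by
nothing and implying the uniform one), but auditors of `Randomized.lean` may want `coinLen` to be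
`FP`-computable (or `run` to receive `1^{coinLen}` explicitly). [folklore] -/
theorem isPolyTime_outputs_any_unary_predicate (a : ℕ → Bool) :
    ∃ B : RandAlg (List Bool) (List Bool), B.IsPolyTime id id ∧
      ∀ x : List Bool, B.pr id x {[a x.length]} = 1 :=
  ⟨adviceAlg a, isPolyTime_adviceAlg a, pr_adviceAlg a⟩

end Summit.QuantumAdvantage.QuantumAdvantage.Theorems.PureCubicClassNumberHard.Negative
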